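import Summits.BirchSwinnertonDyer.BirchSwinnertonDyer.Theorems.ErratumRoadFiveAuxPrimeSupply
import HarnessLib

/-!
# Route `ErratumRoadFive` (rung K2), crux `NonSurjCorner` (item stmt-BirchSwinnertonDyer-19065), line `Lines/hybrid.lean`, r22 slot 6″
# (the Chebotarev–Kummer auxiliary-prime supply AT THE NON-SURJECTIVE CORNER IMAGE): the KUMMER DESCENT (L2) for images of order prime to `p`
# (cell `bsd-stepL`, seat `bsd-stepL-corner-p1` g18; `--supports stmt-BirchSwinnertonDyer-19065 --as helper`)

WHY THIS FILE. Road B for 19715 (bsd-idea-9's aux-norm lever) derives Gross's E′-label at the split carriers from an auxiliary inert prime supplied by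
Chebotarev in `K(E[p], ζ_{p^E}, γ^{1/p})`; its proof (`AuxPrimeSupply.auxiliaryPrimeSupply`, -w2 g5) uses the SURJECTIVE mod-`p` image in exactly two
lemmas, one of which is the SL₂-descent `AuxPrimeSupply.smul_eq_of_fixed_by_ker_galoisRep`: «`y` (`y^p = x`, `x ∈ K`) fixed by `res Γ_K ∩ Stab ζ ∩ ker ρ̄`
⇒ `y` fixed by `res Γ_K ∩ Stab ζ`», proved there from the perfectness of `SL₂(𝔽_p) = ρ̄(…)`. On the (T4′) corner `ρ̄_{E,p}` is NOT onto; but its image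
(the full `S4`-preimage at 5, the full split-Cartan normaliser at 5 ∕ 7 — memo CORNER-G18 §3) has order PRIME TO `p`, and then the same descent holds for a
softer reason: the Kummer character `g ↦ g y ∕ y` of `H₀ = res Γ_K ∩ Stab ζ` into `μ_p` is trivial on `H₀ ∩ ker ρ̄`, so `ω_g^{ord ρ̄(g)} = 1` with
`p ∤ ord ρ̄(g)`, and `ω_g^p = 1` — hence `ω_g = 1`. This file proves that variant, keyed on the one hypothesis `p ∤ |ρ̄_{E,p}(Γ_ℚ)|` (no surjectivity, no
`p ≥ 5`, no `[K : ℚ] = 2`).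
* §1 `AuxPrimeSupply.smul_eq_of_fixed_by_ker_galoisRep_of_not_dvd_card` — the descent for images of order prime to `p`;
* §2 `AuxPrimeSupply.kummerExclusion_of_not_dvd_card` — -w2 g5's `kummerExclusion` with `hsurj` ↦ `p ∤ |ρ̄(Γ_ℚ)|` (proof verbatim, §1 swapped in).

HONEST FRAMING: TWO THEOREMS (no definition, no named fact, no `sorry`); pure Galois∕group theory; it is step (L2) of the discharge of r22's slot 6″
(`stub_cornerAuxPrimeSupply57`); the input `p ∤ |ρ̄(Γ_ℚ)|` on the corner (from `E[p]` irreducible, `ρ̄` not onto, multiplicative at `p`) and step (L1)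
(the Frobenius pre-witness) are NOT here. Nothing about any curve's BSD; 19065 NOT closed; BSD is not advanced; T7.
References (locators only): [cite: GrossLMS1991, §9] [cite: Serre1972, §2] [cite: Cox2013, §8.B (Kummer theory)].
-/

noncomputable section

set_option autoImplicit false
set_option linter.dupNamespace false -- `Summit.BirchSwinnertonDyer.BirchSwinnertonDyer` (summit = problem), tree-wide

open scoped Classical NumberField MatrixGroups Pointwise nonZeroDivisors
open WeierstrassCurve NumberField Field Matrix IsDedekindDomain
open Literature.NumberTheory.GaloisRepresentations Literature.NumberTheory.EllipticCurves
open Literature.NumberTheory.NumberFields.RingClassField Literature.NumberTheory.QuadraticFields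

namespace Summit.BirchSwinnertonDyer.BirchSwinnertonDyer.Theorems.AuxPrimeSupply

/-- **Kummer descent for a mod-`p` image of order prime to `p` (the corner variant of `smul_eq_of_fixed_by_ker_galoisRep`).** `H = res Γ_K ≤ Γ_ℚ`,
`ζ` a primitive `p^E`-th root of unity (`E ≥ 1`), `y ∈ ℚ̄` with `y^p = x` and `x` fixed by `H`; if `p ∤ |ρ̄_{E,p}(Γ_ℚ)|` and `y` is fixed by every
`g ∈ H ∩ Stab ζ` with `ρ̄_{E,p}(g) = 1`, then `y` is fixed by all of `H ∩ Stab ζ`. Proof: `ω_g = g y ∕ y` is a `μ_p`-valued character of `H₀ = H ∩ Stab ζ`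
(its values are `p`-th roots of unity, fixed by `H₀` because `H₀` fixes `ζ_p = ζ^{p^{E-1}}`), trivial on `H₀ ∩ ker ρ̄`; for `g ∈ H₀` and
`n = ord ρ̄(g)` one has `ρ̄(g^n) = 1`, so `ω_g^n = ω_{g^n} = 1`, and `ω_g^p = 1`; as `n ∣ |ρ̄(Γ_ℚ)|` is prime to `p`, `ω_g = ω_g^{gcd(n,p)} = 1`.
[cite: GrossLMS1991, §9] [cite: Serre1972, §2] -/
theorem smul_eq_of_fixed_by_ker_galoisRep_of_not_dvd_card (W : WeierstrassCurve ℚ) [W.IsElliptic] {K : Type}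
    [Field K] [NumberField K] {p : ℕ} [Fact p.Prime]
    (hcop : ¬ p ∣ Nat.card (galoisRepTorsion W p).range) {E : ℕ} [NeZero (p ^ E)] (hE : 1 ≤ E)
    {ζ : AlgebraicClosure ℚ} (hζ : IsPrimitiveRoot ζ (p ^ E)) {x y : AlgebraicClosure ℚ}
    (hx : ∀ g ∈ (absGaloisRestrict ℚ K).range, g • x = x) (hyp : y ^ p = x)
    (hy : ∀ g ∈ (absGaloisRestrict ℚ K).range, g • ζ = ζ → galoisRepTorsion W p g = 1 →
      g • y = y) :
    ∀ g ∈ (absGaloisRestrict ℚ K).range, g • ζ = ζ → g • y = y := by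
  have hp : p.Prime := Fact.out
  set H := (absGaloisRestrict ℚ K).range with hH
  by_cases hy0 : y = 0
  · intro g _ _; rw [hy0, smul_zero]
  -- `H₀ = H ∩ Stab ζ`, `S = H₀ ∩ Stab y`
  set H₀ : Subgroup (absoluteGaloisGroup ℚ) := H ⊓ MulAction.stabilizer _ ζ with hH₀
  set S : Subgroup (absoluteGaloisGroup ℚ) := H₀ ⊓ MulAction.stabilizer _ y with hS
  have hmemH₀ : ∀ g, g ∈ H₀ ↔ g ∈ H ∧ g • ζ = ζ := fun g ↦ by
    rw [hH₀, Subgroup.mem_inf, MulAction.mem_stabilizer_iff]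
  have hmemS : ∀ g, g ∈ S ↔ g ∈ H₀ ∧ g • y = y := fun g ↦ by
    rw [hS, Subgroup.mem_inf, MulAction.mem_stabilizer_iff]
  -- the cocycle `ω_g = g y / y` on `H₀`: a `p`-th root of unity fixed by `H₀`, multiplicative
  have hω : ∀ g ∈ H₀, (g • y * y⁻¹) ^ p = 1 := fun g hg ↦ by
    rw [mul_pow, ← smul_pow', hyp, hx g ((hmemH₀ g).mp hg).1, inv_pow, ← hyp,
      mul_inv_cancel₀ (pow_ne_zero p hy0)]
  have hωfix : ∀ g ∈ H₀, ∀ h ∈ H₀, h • (g • y * y⁻¹) = g • y * y⁻¹ := fun g hg h hh ↦ by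
    have hpow : (g • y * y⁻¹) ^ (p ^ E) = 1 := by
      obtain ⟨k, hk⟩ : p ∣ p ^ E := dvd_pow_self p (by omega)
      rw [hk, pow_mul, hω g hg, one_pow]
    exact smul_eq_self_of_cyclotomicCharacter_eq_one hE
      (cyclotomicCharacter_eq_one_of_smul_eq hζ ((hmemH₀ h).mp hh).2) hpow
  have hmul : ∀ g ∈ H₀, ∀ h ∈ H₀, (g * h) • y * y⁻¹ = (g • y * y⁻¹) * (h • y * y⁻¹) :=
    fun g hg h hh ↦ by
    have h1 : h • y = (h • y * y⁻¹) * y := by rw [inv_mul_cancel_right₀ hy0]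
    rw [mul_smul, h1, smul_mul', hωfix h hh g hg]
    field_simp
  have hone : ∀ g ∈ H₀, (g • y * y⁻¹ = 1 ↔ g • y = y) := fun g _ ↦ by
    rw [mul_inv_eq_one₀ hy0]
  -- the kernel of `ρ̄` inside `H₀` fixes `y`
  set R := galoisRepTorsion W p with hR
  have hker : ∀ g ∈ H₀, R g = 1 → g ∈ S := fun g hg h1 ↦
    (hmemS g).mpr ⟨hg, hy g ((hmemH₀ g).mp hg).1 ((hmemH₀ g).mp hg).2 h1⟩
  -- conclusion
  intro g hgH hgζ
  have hg : g ∈ H₀ := (hmemH₀ g).mpr ⟨hgH, hgζ⟩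
  -- `n = ord ρ̄(g)` divides `|ρ̄(Γ_ℚ)|`, hence is prime to `p`
  set n : ℕ := orderOf (⟨R g, ⟨g, rfl⟩⟩ : R.range) with hn
  have hndvd : n ∣ Nat.card R.range := orderOf_dvd_natCard _
  have hpn : ¬ p ∣ n := fun h ↦ hcop (h.trans hndvd)
  have hRn : R (g ^ n) = 1 := by
    have h1 : (⟨R g, ⟨g, rfl⟩⟩ : R.range) ^ n = 1 := pow_orderOf_eq_one _
    rw [map_pow]
    exact congrArg Subtype.val h1
  have hpow : g ^ n ∈ S := hker _ (H₀.pow_mem hg n) hRn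
  -- `ω_g^n = 1` and `ω_g^p = 1`, so `ω_g = 1`
  have hωpow : ∀ m : ℕ, (g ^ m) • y * y⁻¹ = (g • y * y⁻¹) ^ m := by
    intro m
    induction m with
    | zero => rw [pow_zero, one_smul, mul_inv_cancel₀ hy0, pow_zero]
    | succ m ih => rw [pow_succ, hmul _ (H₀.pow_mem hg m) _ hg, ih, pow_succ]
  have h1 : (g • y * y⁻¹) ^ n = 1 := by
    rw [← hωpow, hone _ (H₀.pow_mem hg _)]
    exact ((hmemS _).mp hpow).2
  have h2 : (g • y * y⁻¹) ^ p = 1 := hω g hg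
  have hgcd : n.gcd p = 1 := (Nat.coprime_comm.mp ((Nat.Prime.coprime_iff_not_dvd hp).mpr hpn))
  rw [← hone g hg, ← pow_one (g • y * y⁻¹), ← hgcd]
  exact pow_gcd_eq_one.mpr ⟨h1, h2⟩

/-! ### §2 Kummer exclusion for images of order prime to `p` -/

/-- **KUMMER EXCLUSION for a mod-`p` image of order prime to `p` (the corner variant of -w2 g5's `kummerExclusion`).** Same statement with
`ρ̄_{E,p}` onto replaced by `p ∤ |ρ̄_{E,p}(Γ_ℚ)|`: for the split-prime Kummer witness `γ = β ∕ γ₀(β)` (`v^h = (β)`, `q = v v'` split in the quadratic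
field `K`, `h = ord [v]`), NO `p`-th root of `e(γ)` is fixed by `res Γ_K ∩ Stab ζ_{p^E} ∩ ker ρ̄` — i.e. `γ^{1/p} ∉ K(E[p], ζ_{p^E})`. Proof VERBATIM
from -w2 g5's, with the SL₂-descent replaced by §1's coprime-order descent; the cyclic descent (`exists_fixed_root_of_fixed_by_stabilizer`, `p ≥ 5`) and
-w4's `not_exists_pow_mul_norm_eq_sq` are image-free. [cite: GrossLMS1991, §9] [cite: Serre1972, §2] [cite: Cox2013, §8.B] -/
theorem kummerExclusion_of_not_dvd_card (W : WeierstrassCurve ℚ) [W.IsElliptic] {K : Type} [Field K] [NumberField K]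
    (hK2 : Module.finrank ℚ K = 2) {p : ℕ} [Fact p.Prime] (hp5 : 5 ≤ p)
    (hcop : ¬ p ∣ Nat.card (galoisRepTorsion W p).range) {E : ℕ} [NeZero (p ^ E)] (hE : 1 ≤ E)
    {ζ : AlgebraicClosure ℚ} (hζ : IsPrimitiveRoot ζ (p ^ E)) (e : K →ₐ[ℚ] AlgebraicClosure ℚ)
    (he : ∀ g : absoluteGaloisGroup ℚ, g ∈ (absGaloisRestrict ℚ K).range ↔ ∀ k : K, g • e k = e k)
    {γ₀ : absoluteGaloisGroup ℚ} (hγ₀ : γ₀ ∉ (absGaloisRestrict ℚ K).range)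
    {q : ℕ} (hq : q.Prime) {v v' : HeightOneSpectrum (𝓞 K)} (hvv' : v ≠ v')
    (hfac : Ideal.span {(q : 𝓞 K)} = v.asIdeal * v'.asIdeal) {h : ℕ} (hh0 : 0 < h)
    (hord : ∀ n : ℕ, ClassGroup.mk0 ⟨v.asIdeal, mem_nonZeroDivisors_iff_ne_zero.mpr v.ne_bot⟩ ^ n = 1 →
      h ∣ n)
    {β : 𝓞 K} (hβ : v.asIdeal ^ h = Ideal.span {β}) :
    ∀ y : AlgebraicClosure ℚ, y ^ p = e (β : K) * (γ₀ • e (β : K))⁻¹ →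
      ∃ a : absoluteGaloisGroup ℚ, a ∈ (absGaloisRestrict ℚ K).range ∧ a • ζ = ζ ∧
        galoisRepTorsion W p a = 1 ∧ a • y ≠ y := by
  have hp : p.Prime := Fact.out
  have hp2 : p ≠ 2 := by omega
  haveI : Algebra.IsQuadraticExtension ℚ K := ⟨hK2⟩
  set H := (absGaloisRestrict ℚ K).range with hH
  have hHi : H.index = 2 := (index_range_absGaloisRestrict_eq_finrank ℚ K).trans hK2
  haveI hHn : H.Normal := Subgroup.normal_of_index_eq_two hHi
  intro y hyp
  by_contra hcon
  simp only [not_exists, not_and, not_not] at hcon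
  -- `x = eβ / γ₀(eβ)` is fixed by `H`
  set x := e (β : K) * (γ₀ • e (β : K))⁻¹ with hx
  have hfixβ : ∀ g ∈ H, g • e (β : K) = e (β : K) := fun g hg ↦ (he g).mp hg β
  have hfixβ' : ∀ g ∈ H, g • (γ₀ • e (β : K)) = γ₀ • e (β : K) := fun g hg ↦ by
    have hmem : γ₀⁻¹ * g * γ₀ ∈ H := hHn.conj_mem' g hg γ₀
    calc g • (γ₀ • e (β : K)) = γ₀ • ((γ₀⁻¹ * g * γ₀) • e (β : K)) := by
          rw [mul_smul, mul_smul, smul_inv_smul]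
      _ = γ₀ • e (β : K) := by rw [hfixβ _ hmem]
  have hxfix : ∀ g ∈ H, g • x = x := fun g hg ↦ by
    rw [hx, smul_mul', smul_inv'', hfixβ g hg, hfixβ' g hg]
  -- descent: `y` is fixed by `H ∩ Stab ζ`, then some `y₀` with `y₀^p = x` is fixed by `H`
  have hy1 : ∀ g ∈ H, g • ζ = ζ → g • y = y :=
    smul_eq_of_fixed_by_ker_galoisRep_of_not_dvd_card W hcop hE hζ hxfix hyp
      (fun g hg hζg hρ ↦ hcon g hg hζg hρ)
  obtain ⟨y₀, hy₀p, hy₀⟩ := exists_fixed_root_of_fixed_by_stabilizer hK2 hp5 hE hζ e he hxfix hyp hy1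
  obtain ⟨δ, hδ⟩ := exists_eq_embedding_of_forall_smul e he hy₀
  -- `e(δ)^p · N(β) = e(β)²`
  have hnorm := embedding_mul_smul_eq_norm hK2 e he hγ₀ (β : K)
  have heβ0 : e (β : K) ≠ 0 := by
    rw [map_ne_zero_iff e e.injective, Ne, RingOfIntegers.coe_eq_zero_iff]
    intro h0
    refine pow_ne_zero h v.ne_bot ?_
    rw [hβ, h0]
    exact Ideal.span_singleton_eq_bot.mpr rfl
  have hγβ0 : γ₀ • e (β : K) ≠ 0 := by rw [Ne, smul_eq_zero_iff_eq]; exact heβ0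
  have hN : e (((Algebra.norm ℤ β : ℤ) : K)) =
      algebraMap ℚ (AlgebraicClosure ℚ) (Algebra.norm ℚ (β : K)) := by
    rw [← Algebra.coe_norm_int, map_intCast, map_intCast]
  have hK' : e (δ ^ p * ((Algebra.norm ℤ β : ℤ) : K)) = e ((β : K) ^ 2) := by
    rw [map_mul, map_pow, hδ, hy₀p, hx, hN, ← hnorm, map_pow]
    field_simp
  have hK : (δ ^ p * ((Algebra.norm ℤ β : ℤ) : K)) = (algebraMap (𝓞 K) K β) ^ 2 := by
    rw [← RingOfIntegers.coe_eq_algebraMap]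
    exact e.injective hK'
  exact not_exists_pow_mul_norm_eq_sq hK2 hq hvv' hfac hh0 hord hβ hp hp2 ⟨δ, hK⟩

/-! ### S3♭: the auxiliary prime supply -/

end Summit.BirchSwinnertonDyer.BirchSwinnertonDyer.Theorems.AuxPrimeSupply

end
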